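import Summits.NavierStokesRegularity.FluidComputer.TubeTableFat18
import HarnessLib

/-!
# Kernel run of the fat restart tube, chunks 0 … 5 (bp3 gen 15)

HONEST FRAMING: low prior, high value-of-information experiment on Tao's machine paradigm; NOT a
claim that NS blows up.

Kernel evaluations (`decide +kernel`; no `native_decide`, no extra axioms) of the in-tree tube checker
`runTube` (`P = 60`, 12 Taylor terms, cube `Rt`, read-out `CLt`) on the chunks `cF 0 … cF 5` of
`TubeTableFat18.lean`, each from the recorded boundary state `sF i` to `sF (i+1)`.

[cite: Tao2016AveragedNS, §5.5 Thm 5.3 (5.5)]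
-/

namespace Summit.NavierStokesRegularity.FluidComputer

namespace TubeTableFat18

open Literature.Analysis.FluidPDE.FluidComputer Literature.Analysis.FluidPDE.FluidComputer.TubeTable
open Literature.Analysis.FluidPDE.FluidComputer.ThresholdLevelTable (GIt)

set_option maxHeartbeats 10000000 in
set_option maxRecDepth 200000 in
/-- Chunk 0 of the fat tube run (steps 0 … 49, `h = 2^-11`). [folklore] -/
theorem runF_0 : runTube 60 12 GIt CLt Rt (sF 0) (cF 0) = some (sF (0 + 1)) := by
  decide +kernel

set_option maxHeartbeats 10000000 in
set_option maxRecDepth 200000 in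
/-- Chunk 1 of the fat tube run (steps 50 … 99, `h = 2^-11`). [folklore] -/
theorem runF_1 : runTube 60 12 GIt CLt Rt (sF 1) (cF 1) = some (sF (1 + 1)) := by
  decide +kernel

set_option maxHeartbeats 10000000 in
set_option maxRecDepth 200000 in
/-- Chunk 2 of the fat tube run (steps 100 … 149, `h = 2^-11`). [folklore] -/
theorem runF_2 : runTube 60 12 GIt CLt Rt (sF 2) (cF 2) = some (sF (2 + 1)) := by
  decide +kernel

set_option maxHeartbeats 10000000 in
set_option maxRecDepth 200000 in
/-- Chunk 3 of the fat tube run (steps 150 … 199, `h = 2^-11`). [folklore] -/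
theorem runF_3 : runTube 60 12 GIt CLt Rt (sF 3) (cF 3) = some (sF (3 + 1)) := by
  decide +kernel

set_option maxHeartbeats 10000000 in
set_option maxRecDepth 200000 in
/-- Chunk 4 of the fat tube run (steps 200 … 249, `h = 2^-11`). [folklore] -/
theorem runF_4 : runTube 60 12 GIt CLt Rt (sF 4) (cF 4) = some (sF (4 + 1)) := by
  decide +kernel

set_option maxHeartbeats 10000000 in
set_option maxRecDepth 200000 in
/-- Chunk 5 of the fat tube run (steps 250 … 299, `h = 2^-11`). [folklore] -/
theorem runF_5 : runTube 60 12 GIt CLt Rt (sF 5) (cF 5) = some (sF (5 + 1)) := by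
  decide +kernel

end TubeTableFat18

end Summit.NavierStokesRegularity.FluidComputer
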